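import Summits.CriticalPhenomena.PercolationContinuityZ3.Theorems.PercNearOneGluingNoHeavyLowerTailKnQuestion8CoefficientwiseCoreClassKernelMixCycleFactor
import Summits.CriticalPhenomena.PercolationContinuityZ3.Theorems.PercNearOneGluingNoHeavyLowerTailKnQuestion8CoefficientwiseCoreClassKernelMixSmallCycles
import Summits.CriticalPhenomena.PercolationContinuityZ3.Theorems.PercNearOneGluingNoHeavyLowerTailKnQuestion8CoefficientwiseCoreClassKernelMixJoinMatching

/-!
# Bouquets of cycles are H-spaces: JP and (X2) for all levels of every bouquet (the two-type theorem)

Support file (`--supports stmt-CriticalPhenomena-4575`, closed), prover `prim-cplus-coupling` (gen 66).  No notations, no named facts, no sorries;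
standard axioms.  Memo `prim-cplus-coupling/A5-COUPLING-gen66.md` §2 (COROLLARIES).

`HBundle` packages an H-space (`HSpace.IsHSpace`) with lower levels; `HBundle.unit` is the empty bouquet and `HBundle.consCycle` glues a cycle with
interior edge type `α` (a `CycleFactor`) by `HSpace.isHSpace_prod`; `HBundle.ofInteriorSizes ns` is the bouquet of cycles with `nᵢ + 1` interior edges
(cycle lengths `nᵢ + 3`).  From the invariant H, Hall's theorem gives the injective pool witnesses of the exclusive collisions (`exists_witness_injection`),
and `JoinMatching.jp_of_matchings` / `x2_of_jp` give, for EVERY pair of levels `D, B` and ALL upper sets `A, C` of every such bouquet: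
  JP:   `#(A ∩ (D∖B)) + #(C ∩ (B∖D)) ≤ #((A ∩ T₁) ∪ (C ∩ T₂)) + #(A ∩ C ∩ P)`,   `Tᵢ` = mirrors, `P = NF ∖ (D ∪ B)`  (`HBundle.jp`),
  (X2)  (`HBundle.x2`).
This is the two-type theorem of the Kozma–Nitzan Question-8 'coefficientwise' programme for bouquets of cycles of arbitrary lengths (`HBundle.ofLengths`, loops and
digons via `SmallCycles`); the identification of these product levels with the exact levels of the bundle reduction is left to the assembly with `IET`.
[cite: KozmaNitzan2024, Questions 8–9 (§5.5 p. 36) (context); Harris 1960; Kleitman 1966]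
-/

namespace Summit.CriticalPhenomena.PercolationContinuityZ3.Theorems.Coefficientwise.Bouquet

open Finset HSpace CycleWords CycleFactor SmallCycles JoinMatching ReducedKleitman

/-- An H-space with lower levels, bundled with its carrier type (cf. `ReducedKleitman.NBundle`). -/
structure HBundle : Type 1 where
  /-- carrier -/
  X : Type
  /-- finiteness -/
  [instF : Fintype X]
  /-- decidable equality -/
  [instD : DecidableEq X]
  /-- order -/
  [instP : Preorder X]
  /-- witness region (no full cycle) -/
  NF : Finset X
  /-- mirror -/
  c : X → X
  /-- levels -/
  Level : Finset X → Prop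
  /-- canonical matchings -/
  Φ : Finset X → X → X
  /-- the H-space axioms -/
  isH : IsHSpace NF c Level Φ
  /-- levels are lower sets -/
  lower : ∀ W, Level W → IsLowerSet (W : Set X)

/-- finiteness of a bouquet -/
instance (B : HBundle) : Fintype B.X := B.instF
/-- decidable equality of a bouquet -/
instance (B : HBundle) : DecidableEq B.X := B.instD
/-- the order of a bouquet -/
instance (B : HBundle) : Preorder B.X := B.instP

/-- The empty bouquet. -/
def HBundle.unit : HBundle where
  X := Unit
  NF := {()}
  c := id
  Level := fun _ => True
  Φ := fun _ x => x
  isH := isHSpace_unit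
  lower := fun _ _ => by intro a b _ ha; cases a; cases b; exact ha

section Cons

variable {Xt Yt : Type} [Fintype Xt] [DecidableEq Xt] [Preorder Xt] [Fintype Yt] [DecidableEq Yt] [Preorder Yt]

/-- Fibrewise lower families of a product are lower. -/
theorem isLowerSet_of_fibres {W : Finset (Xt × Yt)} (hL : ∀ x, IsLowerSet ((fibL W x : Finset Yt) : Set Yt))
    (hR : ∀ y, IsLowerSet ((fibR W y : Finset Xt) : Set Xt)) : IsLowerSet (W : Set (Xt × Yt)) := by
  rintro ⟨x, y⟩ ⟨x', y'⟩ ⟨hx, hy⟩ h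
  have h1 : (x', y) ∈ W := mem_fibR.mp (hR y hx (mem_fibR.mpr (mem_coe.mp h)))
  exact mem_coe.mpr (mem_fibL.mp (hL x' hy (mem_fibL.mpr h1)))

end Cons

/-- Glue one more cycle (interior edge type `α`, at least one interior edge) to a bouquet. -/
noncomputable def HBundle.consCycle (B : HBundle) (α : Type) [Fintype α] [DecidableEq α] [Nonempty α] : HBundle where
  X := B.X × (Bool × Finset α × Bool)
  NF := B.NF ×ˢ (univ.erase (topW α))
  c := fun z => (B.c z.1, cw z.2)
  Level := ProdLevel B.Level IsLevel
  Φ := prodPhi cw B.Φ cycPhi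
  isH := isHSpace_prod B.isH isCycleFactor_cycleWords
  lower := fun _ hW => isLowerSet_of_fibres (fun x => (hW.1 x).1) (fun y => B.lower _ (hW.2 y))

/-- Glue a loop (cycle of length one). -/
def HBundle.consLoop (B : HBundle) : HBundle where
  X := B.X × Bool
  NF := B.NF ×ˢ {false}
  c := fun z => (B.c z.1, !z.2)
  Level := ProdLevel B.Level LoopLevel
  Φ := prodPhi (fun b => !b) B.Φ loopPhi
  isH := isHSpace_prod B.isH isCycleFactor_loop
  lower := fun _ hW => isLowerSet_of_fibres
    (fun x => by
      intro a b hba ha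
      have ha' := mem_singleton.mp ((hW.1 x) (mem_coe.mp ha))
      rw [ha'] at hba
      have hb : b = false := le_bot_iff.mp hba
      rw [hb]; rw [ha'] at ha; exact ha)
    (fun y => B.lower _ (hW.2 y))

/-- Glue a digon (cycle of length two). -/
def HBundle.consDigon (B : HBundle) : HBundle where
  X := B.X × (Bool × Bool)
  NF := B.NF ×ˢ (univ.erase (true, true))
  c := fun z => (B.c z.1, (!z.2.1, !z.2.2))
  Level := ProdLevel B.Level DigonLevel
  Φ := prodPhi (fun w => (!w.1, !w.2)) B.Φ digonPhi
  isH := isHSpace_prod B.isH isCycleFactor_digon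
  lower := fun _ hW => isLowerSet_of_fibres
    (fun x => by
      rcases hW.1 x with h | h
      · rw [h]; intro a b _ ha; simp at ha
      · rw [h]; intro a b hba ha
        rw [mem_coe, mem_erase] at ha ⊢
        refine ⟨fun hb => ha.1 ?_, mem_univ _⟩
        rw [hb] at hba
        obtain ⟨a1, a2⟩ := a
        have h1 : true ≤ a1 := hba.1
        have h2 : true ≤ a2 := hba.2
        revert h1 h2
        cases a1 <;> cases a2 <;> decide)
    (fun y => B.lower _ (hW.2 y))

/-- The bouquet of cycles with the given numbers `nᵢ + 1` of interior edges (cycle lengths `nᵢ + 3`), built from the empty bouquet. -/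
noncomputable def HBundle.ofInteriorSizes : List ℕ → HBundle
  | [] => HBundle.unit
  | n :: ns => (HBundle.ofInteriorSizes ns).consCycle (Fin (n + 1))

/-- The bouquet of cycles of the given LENGTHS `ℓᵢ ≥ 1` (an entry `0` is read as a loop as well). -/
noncomputable def HBundle.ofLengths : List ℕ → HBundle
  | [] => HBundle.unit
  | 0 :: ls => (HBundle.ofLengths ls).consLoop
  | 1 :: ls => (HBundle.ofLengths ls).consLoop
  | 2 :: ls => (HBundle.ofLengths ls).consDigon
  | (n + 3) :: ls => (HBundle.ofLengths ls).consCycle (Fin (n + 1))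

section Witness

variable {X : Type} [Fintype X] [DecidableEq X] [Preorder X]

open Classical in
/-- **Pool witnesses from H** (Hall).  In an H-space, for levels `D, B` there is a map `ψ`, injective on the common targets of the exclusive
sources, with `ψ t ∈ NF` above both exclusive sources meeting at `t`. -/
theorem exists_witness_injection {NF : Finset X} {c : X → X} {Level : Finset X → Prop} {Φ : Finset X → X → X}
    (hH : IsHSpace NF c Level Φ) (D B : Finset X) (hD : Level D) (hB : Level B) :
    ∃ ψ : X → X, Set.InjOn ψ ((((D \ B).image (Φ D)) ∩ ((B \ D).image (Φ B)) : Finset X) : Set X) ∧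
      ∀ y₁ ∈ D \ B, ∀ y₂ ∈ B \ D, Φ D y₁ = Φ B y₂ → y₁ ≤ ψ (Φ D y₁) ∧ y₂ ≤ ψ (Φ D y₁) ∧ ψ (Φ D y₁) ∈ NF := by
  set T : Finset X := ((D \ B).image (Φ D)) ∩ ((B \ D).image (Φ B)) with hT
  -- admissible witnesses of a common target
  let N : T → Finset X := fun t => NF.filter (fun p =>
    (∀ y₁ ∈ D \ B, Φ D y₁ = (t : X) → y₁ ≤ p) ∧ (∀ y₂ ∈ B \ D, Φ B y₂ = (t : X) → y₂ ≤ p))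
  have hHall : ∀ s : Finset T, s.card ≤ (s.biUnion N).card := by
    intro s
    set s' : Finset X := s.image (fun t : T => (t : X)) with hs'
    have hcard : s.card = s'.card := by rw [hs', card_image_of_injective _ Subtype.val_injective]
    -- the collision pairs over s'
    set S : Finset (X × X) := ((D \ B) ×ˢ (B \ D)).filter (fun p => Φ D p.1 = Φ B p.2 ∧ Φ D p.1 ∈ s') with hS
    -- |s'| ≤ |S| : every t ∈ s' carries a pair, and t ↦ pair is injective
    have hs'S : s'.card ≤ S.card := by
      have hsub : s' ⊆ S.image (fun p => Φ D p.1) := by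
        intro t ht
        have htT : t ∈ T := by
          obtain ⟨t', _, rfl⟩ := mem_image.mp ht; exact t'.2
        obtain ⟨h1, h2⟩ := mem_inter.mp htT
        obtain ⟨y₁, hy₁, e₁⟩ := mem_image.mp h1
        obtain ⟨y₂, hy₂, e₂⟩ := mem_image.mp h2
        refine mem_image.mpr ⟨(y₁, y₂), mem_filter.mpr ⟨mem_product.mpr ⟨hy₁, hy₂⟩, ?_, ?_⟩, e₁⟩
        · rw [e₁, e₂]
        · rw [e₁]; exact ht
      exact le_trans (card_le_card hsub) card_image_le
    -- the upper set U = union of the common upper cones of the pairs in S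
    set U : Finset X := univ.filter (fun q => ∃ p ∈ S, p.1 ≤ q ∧ p.2 ≤ q) with hU
    have hmemU : ∀ {q}, q ∈ U ↔ ∃ p ∈ S, p.1 ≤ q ∧ p.2 ≤ q := by intro q; simp [hU]
    have hUup : IsUpperSet (U : Set X) := by
      intro a b hab ha
      obtain ⟨p, hp, h1, h2⟩ := hmemU.mp (mem_coe.mp ha)
      exact mem_coe.mpr (hmemU.mpr ⟨p, hp, le_trans h1 hab, le_trans h2 hab⟩)
    have hSbound : S.card ≤ (U ∩ NF).card := by
      refine hH.hall D B hD hB U hUup S ?_ ?_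
      · intro p hp
        obtain ⟨hpDB, _⟩ := mem_filter.mp hp
        obtain ⟨h1, h2⟩ := mem_product.mp hpDB
        exact mem_product.mpr ⟨(mem_sdiff.mp h1).1, (mem_sdiff.mp h2).1⟩
      · intro p hp
        obtain ⟨_, he, _⟩ := mem_filter.mp hp
        exact ⟨he, fun q h1 h2 => hmemU.mpr ⟨p, hp, h1, h2⟩⟩
    -- U ∩ NF ⊆ the union of the admissible witness sets
    have hsub : U ∩ NF ⊆ s.biUnion N := by
      intro q hq
      obtain ⟨hqU, hqNF⟩ := mem_inter.mp hq
      obtain ⟨p, hp, h1, h2⟩ := hmemU.mp hqU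
      obtain ⟨hpDB, he, hps⟩ := mem_filter.mp hp
      obtain ⟨hp1, hp2⟩ := mem_product.mp hpDB
      obtain ⟨t, hts, het⟩ := mem_image.mp hps
      refine mem_biUnion.mpr ⟨t, hts, mem_filter.mpr ⟨hqNF, ?_, ?_⟩⟩
      · intro y₁ hy₁ hey
        have : y₁ = p.1 := hH.inj D hD y₁ (mem_sdiff.mp hy₁).1 p.1 (mem_sdiff.mp hp1).1 (by rw [hey, het])
        rw [this]; exact h1
      · intro y₂ hy₂ hey
        have : y₂ = p.2 := hH.inj B hB y₂ (mem_sdiff.mp hy₂).1 p.2 (mem_sdiff.mp hp2).1 (by rw [hey, het, he])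
        rw [this]; exact h2
    calc s.card = s'.card := hcard
      _ ≤ S.card := hs'S
      _ ≤ (U ∩ NF).card := hSbound
      _ ≤ (s.biUnion N).card := card_le_card hsub
  obtain ⟨f, hfinj, hfN⟩ := (all_card_le_biUnion_card_iff_exists_injective N).1 hHall
  refine ⟨fun x => if h : x ∈ T then f ⟨x, h⟩ else x, ?_, ?_⟩
  · intro a ha b hb hab
    have ha' : a ∈ T := mem_coe.mp ha
    have hb' : b ∈ T := mem_coe.mp hb
    simp only [ha', hb', dif_pos] at hab
    exact congrArg Subtype.val (hfinj hab)
  · intro y₁ hy₁ y₂ hy₂ he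
    have ht : Φ D y₁ ∈ T := mem_inter.mpr ⟨mem_image.mpr ⟨y₁, hy₁, rfl⟩, mem_image.mpr ⟨y₂, hy₂, he.symm⟩⟩
    have hmem := hfN ⟨Φ D y₁, ht⟩
    obtain ⟨hNF, hA, hB'⟩ := mem_filter.mp hmem
    simp only [ht, dif_pos]
    exact ⟨hA y₁ hy₁ rfl, hB' y₂ hy₂ he.symm, hNF⟩

end Witness

/-- **JP on every bouquet H-space** (the two-type theorem, memo gen 66 §2): for all levels `D, B` and all upper sets `A, C`,
`#(A ∩ (D∖B)) + #(C ∩ (B∖D)) ≤ #((A ∩ T₁) ∪ (C ∩ T₂)) + #(A ∩ C ∩ P)` with `Tᵢ = {x | c x ∈ ·}` the mirrors and `P = NF ∖ (D ∪ B)` the pool. -/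
theorem HBundle.jp (H : HBundle) (D B : Finset H.X) (hD : H.Level D) (hB : H.Level B) (A C : Finset H.X)
    (hA : IsUpperSet (A : Set H.X)) (hC : IsUpperSet (C : Set H.X)) :
    (A ∩ (D \ B)).card + (C ∩ (B \ D)).card ≤
      ((A ∩ univ.filter (fun x => H.c x ∈ D)) ∪ (C ∩ univ.filter (fun x => H.c x ∈ B))).card +
        (A ∩ C ∩ (H.NF \ (D ∪ B))).card := by
  classical
  obtain ⟨ψ, hψinj, hψ⟩ := exists_witness_injection H.isH D B hD hB
  refine jp_of_matchings (D \ B) (B \ D) (univ.filter (fun x => H.c x ∈ D)) (univ.filter (fun x => H.c x ∈ B))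
    (H.NF \ (D ∪ B)) (H.Φ D) (H.Φ B) ψ ?_ ?_ ?_ ?_ ?_ hψinj A C hA hC
  · intro y hy
    exact ⟨H.isH.incr D hD y (mem_sdiff.mp hy).1, mem_filter.mpr ⟨mem_univ _, H.isH.mirror D hD y (mem_sdiff.mp hy).1⟩⟩
  · intro a ha b hb e
    exact H.isH.inj D hD a (mem_sdiff.mp (mem_coe.mp ha)).1 b (mem_sdiff.mp (mem_coe.mp hb)).1 e
  · intro y hy
    exact ⟨H.isH.incr B hB y (mem_sdiff.mp hy).1, mem_filter.mpr ⟨mem_univ _, H.isH.mirror B hB y (mem_sdiff.mp hy).1⟩⟩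
  · intro a ha b hb e
    exact H.isH.inj B hB a (mem_sdiff.mp (mem_coe.mp ha)).1 b (mem_sdiff.mp (mem_coe.mp hb)).1 e
  · intro y₁ hy₁ y₂ hy₂ he
    obtain ⟨h1, h2, hNF⟩ := hψ y₁ hy₁ y₂ hy₂ he
    refine ⟨h1, h2, mem_sdiff.mpr ⟨hNF, ?_⟩⟩
    intro hmem
    rcases mem_union.mp hmem with hD' | hB'
    · -- ψ t ∈ D and y₂ ≤ ψ t would put y₂ ∈ D (D lower)
      exact (mem_sdiff.mp hy₂).2 (mem_coe.mp (H.lower D hD h2 (mem_coe.mpr hD')))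
    · exact (mem_sdiff.mp hy₁).2 (mem_coe.mp (H.lower B hB h1 (mem_coe.mpr hB')))

/-- **(X2) on every bouquet H-space**: the two-type inequality of the bouquet reduction, for all levels `D, B` and all upper sets `A, C`,
with `NE ⊇` the mirrors (here any finset containing both mirror sets). -/
theorem HBundle.x2 (H : HBundle) (D B : Finset H.X) (hD : H.Level D) (hB : H.Level B) (NE : Finset H.X)
    (hNE₁ : univ.filter (fun x => H.c x ∈ D) ⊆ NE) (hNE₂ : univ.filter (fun x => H.c x ∈ B) ⊆ NE)
    (A C : Finset H.X) (hA : IsUpperSet (A : Set H.X)) (hC : IsUpperSet (C : Set H.X)) :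
    ((A \ C) ∩ (D \ B)).card + ((C \ A) ∩ (B \ D)).card ≤
      ((A \ C) ∩ univ.filter (fun x => H.c x ∈ D)).card + ((C \ A) ∩ univ.filter (fun x => H.c x ∈ B)).card +
        (A ∩ C ∩ NE).card + (A ∩ C ∩ (H.NF \ (D ∪ B))).card :=
  x2_of_jp A C (D \ B) (B \ D) _ _ NE _ hNE₁ hNE₂ (H.jp D B hD hB A C hA hC)

/-- **The two-type theorem for bouquets of cycles** (any lengths): JP for all levels and all upper sets on `HBundle.ofLengths ls`. -/
theorem jp_bouquet (ls : List ℕ) :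
    let H := HBundle.ofLengths ls
    ∀ (D B : Finset H.X), H.Level D → H.Level B → ∀ (A C : Finset H.X), IsUpperSet (A : Set H.X) → IsUpperSet (C : Set H.X) →
      (A ∩ (D \ B)).card + (C ∩ (B \ D)).card ≤
        ((A ∩ univ.filter (fun x => H.c x ∈ D)) ∪ (C ∩ univ.filter (fun x => H.c x ∈ B))).card +
          (A ∩ C ∩ (H.NF \ (D ∪ B))).card :=
  fun D B hD hB A C hA hC => (HBundle.ofLengths ls).jp D B hD hB A C hA hC

end Summit.CriticalPhenomena.PercolationContinuityZ3.Theorems.Coefficientwise.Bouquet
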